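import Literature.NumberTheory.NumberFields.EisensteinFieldSelmerNormCubeInert
import Literature.NumberTheory.NumberFields.EisensteinFieldPrimes
import HarnessLib

/-!
# `K(S, 3)` of `ℚ(ζ₃)` with ONE split prime: `S = {λ} ∪ {q ∣ N inert} ∪ {ϖ, ϖ̄}`, `ϖϖ̄ = p ≡ 1 (mod 3)`;
# the norm-cube classes are `[ζ^i ϖ^k ϖ̄^l]` with `k + l ≡ 0 (mod 3)`

Topic `NumberTheory/NumberFields`; namespace `Literature.NumberTheory.NumberFields.K3`. Sequel to
`EisensteinFieldSelmerInert` / `EisensteinFieldSelmerNormCubeInert` (all of `N`'s prime factors inert), adding one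
rational prime `p ≡ 1 (mod 3)`, which SPLITS in `𝓞 K3 = ℤ[ζ]` as `p = ϖ ϖ̄`, `ϖ = a + bζ`, `ϖ̄ = (a − b) − bζ`,
`N(ϖ) = N(ϖ̄) = a² − ab + b² = p` (`EisensteinFieldPrimes`: `prime_mkInt_of_norm_eq_prime`, `mkInt_mul_conj`,
`not_associated_conj`). For the `3`-isogeny descent of Cohen–Pazuki ([CohenPazuki2009], Def. 1.3, Thm. 2.1) on
`V : y² = x³ − 3(mx + b̂)²` this is the Selmer box of the `μ₃`-kernel side when `2b̂√−3` is supported on `λ`, inert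
primes and ONE split prime — the situation of the rank-2 curves 5427b1 (`p = 67`), 9747f1 (`p = 19`), 9882e1 (`p = 61`)
of route ShaPrimaryTransfer's cross-prime programme (no rank-2 curve of conductor `< 10⁴` with a rational `3`-torsion
point has inert support).

* `associated_of_prime_of_dvd_three_mul_split` — a prime element dividing `3Np` is associated to `λ`, an inert `q ∣ N`,
  `ϖ` or `ϖ̄`;
* **`exists_normal_form_split`** — `3 ∣ ord_v(x)` for all `v ∌ 3Np` ⇒
  `x = s ζ^i (ζ − 1)^j (∏_{q ∣ N} q^{e_q}) ϖ^k ϖ̄^l w³`, `s = ±1`, all exponents `< 3`;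
* `norm_normalForm_split` — its norm is `3^j (∏ q^{2e_q}) p^{k+l} N(w)³`;
* **`exponents_of_norm_cube_split`** — norm a rational cube ⇒ `j = 0`, `e_q = 0`, `3 ∣ k + l`;
* **`exists_cubeClass_eq_of_norm_cube_split`** — hence `[x] = [ζ^i ϖ^k ϖ̄^l]` with `(k, l) ∈ {(0,0), (1,2), (2,1)}`:
  the norm-cube box is the `𝔽₃`-plane `⟨[ζ], [ϖ ϖ̄²]⟩` (note `[ϖ² ϖ̄] = [ϖ ϖ̄²]²`).

## References

* [CohenPazuki2009] H. Cohen, F. Pazuki, Acta Arith. 140 (2009), Definition 1.3 (`G₃`), Theorem 2.1.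
* [SilvermanAEC2009] J. H. Silverman, *AEC* 2nd ed., Prop. VIII.1.6 (`K(S, n)`).
* [IrelandRosen1990] K. Ireland, M. Rosen, GTM 84, Prop. 9.1.4 (primes of `ℤ[ω]`).
-/

noncomputable section

open QuadraticAlgebra NumberField IsDedekindDomain IsDedekindDomain.HeightOneSpectrum
open WithZero (log exp)
open scoped WithZero
open Literature.NumberTheory.EllipticCurves.MordellDescent (cubeClass CubeUnits cubeClass_mul
  cubeClass_neg cubeClass_mul_pow_three cubeClass_eq_cubeClass_iff cubeClass_pow_three)

namespace Literature.NumberTheory.NumberFields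

namespace K3

section Split

variable {N : ℕ} (hN0 : N ≠ 0) (hN : ∀ q ∈ N.primeFactors, q = 2 ∨ q % 3 = 2)
  {p : ℕ} (hp : p.Prime) (hp1 : p % 3 = 1) {a b : ℤ} (hab : a ^ 2 - a * b + b ^ 2 = p)

/-! ## The generators: `λ`, the inert `q ∣ N`, `ϖ = a + bζ`, `ϖ̄ = (a − b) − bζ` -/

include hab in
/-- `(p) = ϖ ϖ̄` in `𝓞 K3` (cast from `ℕ`). [cite: IrelandRosen1990, Prop. 9.1.4] -/
theorem natCast_eq_mkInt_mul_conj : ((p : ℕ) : 𝓞 K3) = mkInt a b * mkInt (a - b) (-b) := by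
  rw [mkInt_mul_conj, hab, Int.cast_natCast]

include hN0 hN hp hab in
/-- **A prime element dividing `3Np` is associated to `λ`, to an inert prime factor `q` of `N`, to `ϖ` or to `ϖ̄`.**
[cite: IrelandRosen1990, Prop. 9.1.4] -/
theorem associated_of_prime_of_dvd_three_mul_split {r : 𝓞 K3} (hr : Prime r)
    (h : r ∣ ((3 * N * p : ℕ) : 𝓞 K3)) :
    Associated r lamInt ∨ (∃ q ∈ N.primeFactors, Associated r ((q : ℕ) : 𝓞 K3)) ∨
      Associated r (mkInt a b) ∨ Associated r (mkInt (a - b) (-b)) := by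
  have hsplit : ((3 * N * p : ℕ) : 𝓞 K3) = ((3 * N : ℕ) : 𝓞 K3) * (mkInt a b * mkInt (a - b) (-b)) := by
    rw [← natCast_eq_mkInt_mul_conj hab]; push_cast; ring
  rw [hsplit] at h
  rcases hr.dvd_or_dvd h with h3N | hP
  · rcases associated_of_prime_of_dvd_three_mul hN0 hN hr h3N with h1 | h2
    · exact Or.inl h1
    · exact Or.inr (Or.inl h2)
  · rcases hr.dvd_or_dvd hP with h1 | h2
    · exact Or.inr (Or.inr (Or.inl (hr.irreducible.associated_of_dvd
        (prime_mkInt_of_norm_eq_prime hp hab).irreducible h1)))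
    · exact Or.inr (Or.inr (Or.inr (hr.irreducible.associated_of_dvd
        (prime_mkInt_of_norm_eq_prime hp ((norm_conj_eq a b).trans hab)).irreducible h2)))

include hN0 hN hp hab in
/-- Every prime element dividing `3Np` is associated to one of the generators `λ, q ∣ N, ϖ, ϖ̄`, as a family on
`Option N.primeFactors ⊕ Bool` (`none ↦ λ`, `some q ↦ q`, `true ↦ ϖ`, `false ↦ ϖ̄`). [folklore] -/
private theorem gensSplit_spec (r : 𝓞 K3) (hr : Prime r) (h : r ∣ ((3 * N * p : ℕ) : 𝓞 K3)) :
    ∃ i : Option N.primeFactors ⊕ Bool, Associated r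
      ((fun i : Option N.primeFactors ⊕ Bool => Sum.elim (fun o : Option N.primeFactors => Option.elim o lamInt (fun q => ((q : ℕ) : 𝓞 K3)))
      (fun c : Bool => cond c (mkInt a b) (mkInt (a - b) (-b))) i) i) := by
  rcases associated_of_prime_of_dvd_three_mul_split hN0 hN hp hab hr h with h | ⟨q, hq, h⟩ | h | h
  · exact ⟨Sum.inl none, h⟩
  · exact ⟨Sum.inl (some ⟨q, hq⟩), h⟩
  · exact ⟨Sum.inr true, h⟩
  · exact ⟨Sum.inr false, h⟩

/-! ## The normal form -/

include hN0 hN hp hab in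
/-- **Normal form of `K(S, 3)`, `S = {λ} ∪ {q ∣ N} ∪ {ϖ, ϖ̄}`** (`N`'s prime factors inert, `ϖ ϖ̄ = p ≡ 1 (3)` split):
if `x ∈ K3ˣ` has `3 ∣ ord_v(x)` for every finite place `v ∌ 3Np`, then
`x = s ζ^i (ζ − 1)^j (∏_{q ∣ N} q^{e q}) ϖ^k ϖ̄^l w³` with `s = ±1`, `i, j, e q, k, l < 3`, `w ≠ 0`.
[cite: SilvermanAEC2009, Prop. VIII.1.6 (proof)] -/
theorem exists_normal_form_split {x : K3} (hx : x ≠ 0)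
    (hval : ∀ v : HeightOneSpectrum (𝓞 K3), ((3 * N * p : ℕ) : 𝓞 K3) ∉ v.asIdeal →
      (3 : ℤ) ∣ log (v.valuation K3 x)) :
    ∃ (s : ℤ) (i j : ℕ) (e : ℕ → ℕ) (k l : ℕ) (w : K3), (s = 1 ∨ s = -1) ∧ i < 3 ∧ j < 3 ∧ (∀ q, e q < 3) ∧
      k < 3 ∧ l < 3 ∧ w ≠ 0 ∧
      x = s * zeta ^ i * (zeta - 1) ^ j * (∏ q ∈ N.primeFactors, (q : K3) ^ e q) *
        (⟨a, b⟩ : K3) ^ k * (⟨a - b, -b⟩ : K3) ^ l * w ^ 3 := by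
  classical
  obtain ⟨u, e, w, he, hw, h⟩ := exists_eq_unit_mul_prod_pow_mul_pow (K := K3) ((3 * N * p : ℕ) : 𝓞 K3)
    (fun i : Option N.primeFactors ⊕ Bool => Sum.elim (fun o : Option N.primeFactors => Option.elim o lamInt (fun q => ((q : ℕ) : 𝓞 K3)))
      (fun c : Bool => cond c (mkInt a b) (mkInt (a - b) (-b))) i)
    (gensSplit_spec hN0 hN hp hab) (n := 3) (by norm_num) hx hval
  obtain ⟨s, i, hs, hi, hu⟩ := exists_coe_unit_eq u
  refine ⟨s, i, e (Sum.inl none), fun q => if hq : q ∈ N.primeFactors then e (Sum.inl (some ⟨q, hq⟩)) else 0,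
    e (Sum.inr true), e (Sum.inr false), w, hs, hi, he _, fun q => ?_, he _, he _, hw, ?_⟩
  · by_cases hq : q ∈ N.primeFactors
    · dsimp only; rw [dif_pos hq]; exact he _
    · dsimp only; rw [dif_neg hq]; norm_num
  · rw [h, Fintype.prod_sum_type, Fintype.prod_option, Fintype.prod_bool, hu]
    have hprod : (∏ y : N.primeFactors, ((((fun i : Option N.primeFactors ⊕ Bool => Sum.elim (fun o : Option N.primeFactors => Option.elim o lamInt (fun q => ((q : ℕ) : 𝓞 K3)))
      (fun c : Bool => cond c (mkInt a b) (mkInt (a - b) (-b))) i)) (Sum.inl (some y)) : 𝓞 K3) : K3) ^ e (Sum.inl (some y))) =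
        ∏ q ∈ N.primeFactors, (q : K3) ^ (if hq : q ∈ N.primeFactors then e (Sum.inl (some ⟨q, hq⟩)) else 0) := by
      rw [← Finset.prod_coe_sort N.primeFactors]
      refine Finset.prod_congr rfl fun y _ => ?_
      rw [dif_pos y.2]
      simp only [Sum.elim_inl, Option.elim]
      rw [coe_natCast_ringOfIntegers]
    rw [hprod]
    simp only [Sum.elim_inl, Sum.elim_inr, Option.elim, cond_true, cond_false, coe_lamInt, coe_mkInt]
    push_cast
    ring

/-! ## Norms -/

include hab in
/-- `N(ϖ) = p` for `ϖ = a + bζ`. [cite: IrelandRosen1990, Prop. 9.1.4] -/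
theorem norm_varpi : QuadraticAlgebra.norm (⟨a, b⟩ : K3) = p := by
  have h := norm_mk (a : ℚ) (b : ℚ)
  rw [h]; exact_mod_cast hab

include hab in
/-- `N(ϖ̄) = p` for `ϖ̄ = (a − b) − bζ`. [cite: IrelandRosen1990, Prop. 9.1.4] -/
theorem norm_varpi_conj : QuadraticAlgebra.norm (⟨a - b, -b⟩ : K3) = p := by
  have h := norm_mk ((a - b : ℤ) : ℚ) ((-b : ℤ) : ℚ)
  push_cast at h
  rw [h]
  have h2 := (norm_conj_eq a b).trans hab
  exact_mod_cast h2

/-- `N(s) = 1` for `s = ±1` (private copy). [cite: CohenPazuki2009, Definition 1.3 (G₃)] -/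
private theorem norm_sign'' {s : ℤ} (hs : s = 1 ∨ s = -1) : QuadraticAlgebra.norm ((s : ℤ) : K3) = 1 := by
  rw [norm_intCast]; rcases hs with rfl | rfl <;> norm_num

include hab in
/-- **The norm of a split normal form**: `N(s ζ^i (ζ−1)^j (∏ q^{e_q}) ϖ^k ϖ̄^l w³) = 3^j (∏ (q²)^{e_q}) p^{k+l} N(w)³`.
[cite: CohenPazuki2009, Definition 1.3 (G₃) with Theorem 2.1] -/
theorem norm_normalForm_split {s : ℤ} (hs : s = 1 ∨ s = -1) (i j : ℕ) (e : ℕ → ℕ) (k l : ℕ) (w : K3) :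
    QuadraticAlgebra.norm ((s : K3) * zeta ^ i * (zeta - 1) ^ j * (∏ q ∈ N.primeFactors, (q : K3) ^ e q) *
        (⟨a, b⟩ : K3) ^ k * (⟨a - b, -b⟩ : K3) ^ l * w ^ 3) =
      3 ^ j * (∏ q ∈ N.primeFactors, ((q : ℚ) ^ 2) ^ e q) * (p : ℚ) ^ (k + l) * (QuadraticAlgebra.norm w) ^ 3 := by
  rw [map_mul, map_mul, map_mul, map_mul, map_mul, map_mul, map_pow, map_pow, map_pow, map_pow, map_pow, norm_prodPow,
    norm_zeta, norm_zeta_sub_one, norm_varpi hab, norm_varpi_conj hab]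
  have hs1 : QuadraticAlgebra.norm (s : K3) = 1 := by
    have := norm_sign'' hs
    exact_mod_cast this
  rw [hs1, pow_add]
  ring

/-- `N(w) ≠ 0` for `w ≠ 0` (private copy). [cite: CohenPazuki2009, Definition 1.3 (G₃)] -/
private theorem norm_ne_zero'' {w : K3} (hw : w ≠ 0) : QuadraticAlgebra.norm w ≠ 0 := by
  intro h0
  have h := algebraMap_norm_eq_mul_star w
  rw [h0, map_zero] at h
  rcases mul_eq_zero.mp h.symm with h1 | h1
  · exact hw h1
  · exact hw (star_eq_zero.mp h1)

/-! ## The norm-cube condition: `j = 0`, `e_q = 0`, `3 ∣ k + l` -/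

include hN0 hN hp hp1 hab in
/-- **The norm-cube condition (one split prime)**: if the norm of a split normal form is the cube of a rational number
then `j = 0`, `e_q = 0` for all `q ∣ N`, and `3 ∣ k + l` — the valuations of `3^j ∏ q^{2e_q} p^{k+l}` at `3`, `q`, `p`
are `j`, `2e_q`, `k + l`. [cite: CohenPazuki2009, Definition 1.3 (G₃) with Theorem 2.1] -/
theorem exponents_of_norm_cube_split {s : ℤ} (hs : s = 1 ∨ s = -1) {i j : ℕ} {e : ℕ → ℕ} {k l : ℕ}
    (hj : j < 3) (he : ∀ q, e q < 3) {w : K3} (hw : w ≠ 0) {r : ℚ}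
    (hr : QuadraticAlgebra.norm ((s : K3) * zeta ^ i * (zeta - 1) ^ j *
      (∏ q ∈ N.primeFactors, (q : K3) ^ e q) * (⟨a, b⟩ : K3) ^ k * (⟨a - b, -b⟩ : K3) ^ l * w ^ 3) = r ^ 3) :
    j = 0 ∧ (∀ q ∈ N.primeFactors, e q = 0) ∧ 3 ∣ k + l := by
  haveI : Fact (Nat.Prime 3) := ⟨Nat.prime_three⟩
  haveI : Fact p.Prime := ⟨hp⟩
  rw [norm_normalForm_split hab hs] at hr
  have hNw := norm_ne_zero'' hw
  set Nw := QuadraticAlgebra.norm w with hNwdef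
  have hprimes : ∀ q ∈ N.primeFactors, q.Prime := fun q hq => Nat.prime_of_mem_primeFactors hq
  have hp0 : (p : ℚ) ≠ 0 := Nat.cast_ne_zero.mpr hp.ne_zero
  have hP : (∏ q ∈ N.primeFactors, ((q : ℚ) ^ 2) ^ e q) ≠ 0 :=
    Finset.prod_ne_zero_iff.mpr fun q hq => pow_ne_zero _ (pow_ne_zero _ (Nat.cast_ne_zero.mpr (hprimes q hq).ne_zero))
  have hA : (3 : ℚ) ^ j * (∏ q ∈ N.primeFactors, ((q : ℚ) ^ 2) ^ e q) * (p : ℚ) ^ (k + l) ≠ 0 :=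
    mul_ne_zero (mul_ne_zero (pow_ne_zero _ (by norm_num)) hP) (pow_ne_zero _ hp0)
  have hr0 : r ≠ 0 := by
    rintro rfl
    rw [zero_pow three_ne_zero] at hr
    exact (mul_ne_zero hA (pow_ne_zero 3 hNw)) hr
  -- `3^j ∏ q^{2e_q} p^{k+l} = (r / N(w))³`
  have key : (3 : ℚ) ^ j * (∏ q ∈ N.primeFactors, ((q : ℚ) ^ 2) ^ e q) * (p : ℚ) ^ (k + l) = (r / Nw) ^ 3 := by
    rw [div_pow, eq_div_iff (pow_ne_zero 3 hNw), hr]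
  have h3N : (3 : ℕ) ∉ N.primeFactors := fun h => not_three_dvd_of_mem_primeFactors hN0 hN h (dvd_refl 3)
  have hpN : p ∉ N.primeFactors := fun h => by rcases hN p h with h2 | h2 <;> omega
  have hp3 : p ≠ 3 := fun h => by omega
  have e3 : (3 : ℚ) = ((3 : ℕ) : ℚ) := by norm_num
  -- valuation at `3`: `j`
  have v3p : padicValRat 3 ((p : ℚ) ^ (k + l)) = 0 := by
    rw [padicValRat.pow, padicValRat.of_nat]
    have : padicValNat 3 p = 0 := padicValNat.eq_zero_of_not_dvd fun h =>
      hp3 ((Nat.prime_dvd_prime_iff_eq Nat.prime_three hp).mp h).symm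
    rw [this]; simp
  have v3 : padicValRat 3 ((3 : ℚ) ^ j * (∏ q ∈ N.primeFactors, ((q : ℚ) ^ 2) ^ e q) * (p : ℚ) ^ (k + l)) = j := by
    rw [padicValRat.mul (mul_ne_zero (pow_ne_zero _ (by norm_num)) hP) (pow_ne_zero _ hp0),
      padicValRat.mul (pow_ne_zero _ (by norm_num)) hP, padicValRat.pow, e3,
      padicValRat.self (by norm_num), padicValRat_prodPow_sq 3 _ hprimes, if_neg h3N, v3p]
    ring
  have d3 : (3 : ℤ) ∣ (j : ℤ) := ⟨padicValRat 3 (r / Nw), by rw [← v3, key, padicValRat.pow]; push_cast; ring⟩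
  -- valuation at `p`: `k + l`
  have vp3 : padicValRat p (3 : ℚ) = 0 := by
    rw [e3, padicValRat.of_nat]
    have : padicValNat p 3 = 0 := padicValNat.eq_zero_of_not_dvd fun h =>
      hp3 ((Nat.prime_dvd_prime_iff_eq hp Nat.prime_three).mp h)
    rw [this]; simp
  have vp : padicValRat p ((3 : ℚ) ^ j * (∏ q ∈ N.primeFactors, ((q : ℚ) ^ 2) ^ e q) * (p : ℚ) ^ (k + l)) =
      ((k + l : ℕ) : ℤ) := by
    rw [padicValRat.mul (mul_ne_zero (pow_ne_zero _ (by norm_num)) hP) (pow_ne_zero _ hp0),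
      padicValRat.mul (pow_ne_zero _ (by norm_num)) hP, padicValRat.pow, vp3,
      padicValRat_prodPow_sq p _ hprimes, if_neg hpN, padicValRat.pow, padicValRat.self hp.one_lt]
    push_cast; ring
  have dp : (3 : ℤ) ∣ ((k + l : ℕ) : ℤ) := ⟨padicValRat p (r / Nw), by rw [← vp, key, padicValRat.pow]; push_cast; ring⟩
  refine ⟨by omega, fun q₀ hq₀ => ?_, by omega⟩
  -- valuation at an inert `q₀ ∣ N`: `2 e_{q₀}`
  haveI : Fact q₀.Prime := ⟨hprimes q₀ hq₀⟩
  have hq3 : q₀ ≠ 3 := fun h => h3N (h ▸ hq₀)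
  have hqp : q₀ ≠ p := fun h => hpN (h ▸ hq₀)
  have v30 : padicValRat q₀ (3 : ℚ) = 0 := by
    rw [e3, padicValRat.of_nat]
    have : padicValNat q₀ 3 = 0 := padicValNat.eq_zero_of_not_dvd fun h =>
      hq3 ((Nat.prime_dvd_prime_iff_eq (hprimes q₀ hq₀) Nat.prime_three).mp h)
    rw [this]; simp
  have vqp : padicValRat q₀ ((p : ℚ) ^ (k + l)) = 0 := by
    rw [padicValRat.pow, padicValRat.of_nat]
    have : padicValNat q₀ p = 0 := padicValNat.eq_zero_of_not_dvd fun h =>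
      hqp ((Nat.prime_dvd_prime_iff_eq (hprimes q₀ hq₀) hp).mp h)
    rw [this]; simp
  have vq : padicValRat q₀ ((3 : ℚ) ^ j * (∏ q ∈ N.primeFactors, ((q : ℚ) ^ 2) ^ e q) * (p : ℚ) ^ (k + l)) =
      2 * (e q₀ : ℤ) := by
    rw [padicValRat.mul (mul_ne_zero (pow_ne_zero _ (by norm_num)) hP) (pow_ne_zero _ hp0),
      padicValRat.mul (pow_ne_zero _ (by norm_num)) hP, padicValRat.pow, v30,
      padicValRat_prodPow_sq q₀ _ hprimes, if_pos hq₀, vqp]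
    ring
  have dq : (3 : ℤ) ∣ 2 * (e q₀ : ℤ) := ⟨padicValRat q₀ (r / Nw), by rw [← vq, key, padicValRat.pow]; push_cast; ring⟩
  have := he q₀
  omega

/-! ## The norm-cube box with one split prime -/

include hN0 hN hp hp1 hab in
/-- **`G₃ ∩ K(S, 3)` for `S = {λ} ∪ {q ∣ N inert} ∪ {ϖ, ϖ̄}`**: an element `x ∈ K3ˣ` with `3 ∣ ord_v(x)` for every
finite place `v ∌ 3Np` and whose norm is a rational cube has cube class `[ζ^i ϖ^k ϖ̄^l]` with `i, k, l < 3` and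
`3 ∣ k + l`, i.e. `(k, l) ∈ {(0,0), (1,2), (2,1)}`: the box is the `𝔽₃`-plane spanned by `[ζ]` and `[ϖ ϖ̄²]`.
[cite: CohenPazuki2009, Definition 1.3 and Theorem 2.1] -/
theorem exists_cubeClass_eq_of_norm_cube_split {x : K3} (hx : x ≠ 0)
    (hval : ∀ v : HeightOneSpectrum (𝓞 K3), ((3 * N * p : ℕ) : 𝓞 K3) ∉ v.asIdeal →
      (3 : ℤ) ∣ log (v.valuation K3 x))
    (hnorm : ∃ r : ℚ, QuadraticAlgebra.norm x = r ^ 3) :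
    ∃ i k l : ℕ, i < 3 ∧ k < 3 ∧ l < 3 ∧ (k = 0 ∧ l = 0 ∨ k = 1 ∧ l = 2 ∨ k = 2 ∧ l = 1) ∧
      cubeClass x = cubeClass (zeta ^ i * (⟨a, b⟩ : K3) ^ k * (⟨a - b, -b⟩ : K3) ^ l) := by
  obtain ⟨s, i, j, e, k, l, w, hs, hi, hj, he, hk, hl, hw, hx_eq⟩ := exists_normal_form_split hN0 hN hp hab hx hval
  obtain ⟨r, hr⟩ := hnorm
  rw [hx_eq] at hr
  obtain ⟨rfl, he0, hkl⟩ := exponents_of_norm_cube_split hN0 hN hp hp1 hab hs hj he hw hr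
  refine ⟨i, k, l, hi, hk, hl, by omega, ?_⟩
  have hprod : (∏ q ∈ N.primeFactors, (q : K3) ^ e q) = 1 :=
    Finset.prod_eq_one fun q hq => by rw [he0 q hq, pow_zero]
  have hz : (zeta : K3) ≠ 0 := isPrimitiveRoot_zeta.ne_zero (by norm_num)
  have hs0 : (s : K3) ≠ 0 := by rcases hs with rfl | rfl <;> norm_num
  have hp0 : (p : ℤ) ≠ 0 := by exact_mod_cast hp.ne_zero
  have hϖ : (⟨a, b⟩ : K3) ≠ 0 := fun h0 => by
    have ha : (a : ℚ) = 0 := congrArg QuadraticAlgebra.re h0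
    have hb : (b : ℚ) = 0 := congrArg QuadraticAlgebra.im h0
    have ha' : a = 0 := by exact_mod_cast ha
    have hb' : b = 0 := by exact_mod_cast hb
    subst ha'; subst hb'
    exact hp0 (by rw [← hab]; ring)
  have hϖ' : (⟨a - b, -b⟩ : K3) ≠ 0 := fun h0 => by
    have ha : (a : ℚ) - b = 0 := congrArg QuadraticAlgebra.re h0
    have hb : -(b : ℚ) = 0 := congrArg QuadraticAlgebra.im h0
    have hb' : b = 0 := by exact_mod_cast (neg_eq_zero.mp hb)
    subst hb'
    have ha' : a = 0 := by exact_mod_cast (show (a : ℚ) = 0 by simpa using ha)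
    subst ha'
    exact hp0 (by rw [← hab]; ring)
  have hmon : zeta ^ i * (⟨a, b⟩ : K3) ^ k * (⟨a - b, -b⟩ : K3) ^ l ≠ 0 :=
    mul_ne_zero (mul_ne_zero (pow_ne_zero _ hz) (pow_ne_zero _ hϖ)) (pow_ne_zero _ hϖ')
  have hcore : (s : K3) * (zeta ^ i * (⟨a, b⟩ : K3) ^ k * (⟨a - b, -b⟩ : K3) ^ l) ≠ 0 := mul_ne_zero hs0 hmon
  rw [hx_eq, hprod, pow_zero, mul_one, mul_one,
    show (s : K3) * zeta ^ i * (⟨a, b⟩ : K3) ^ k * (⟨a - b, -b⟩ : K3) ^ l * w ^ 3 =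
      (s : K3) * (zeta ^ i * (⟨a, b⟩ : K3) ^ k * (⟨a - b, -b⟩ : K3) ^ l) * w ^ 3 by ring,
    cubeClass_mul_pow_three hcore hw]
  -- `s = s³` for `s = ±1`
  have hs3 : (s : K3) = (s : K3) ^ 3 := by rcases hs with rfl | rfl <;> norm_num
  rw [hs3, mul_comm, cubeClass_mul_pow_three hmon hs0]

end Split

end K3

end Literature.NumberTheory.NumberFields

end
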